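import Summits.BirchSwinnertonDyer.BirchSwinnertonDyer.Theorems.AlignedTransportAtTwoBSDOfMainConjectureRankOneAtTwoEulerCharAtTwoAssemblyKummer
import HarnessLib

/-!
# Route `AlignedTransportAtTwo`, crux C3′ `BSDOfMainConjectureRankOneAtTwo` (stmt-BirchSwinnertonDyer-23008), line `birth` v5:
# the CANONICAL derived Kummer map of the positive-rank assembly, on classes

HONEST FRAMING (cell `bsd-f1-sign2`, attach seat `bsd-line-att-p4` g7 under the C3′ lead lineage `bsd-line-att-p1`;
`--supports stmt-BirchSwinnertonDyer-23008 --as helper`). BSD is NOT proved; C3′ is NOT closed; nothing is asserted. THEOREMS ONLY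
(no `def`, no named fact, no `sorry`). Fourth file of the positive-rank assembly (`…EulerCharAtTwoAssembly`, `…Kummer`, `…Divisible`).

WHY. The assembly files quantify over ALL additive identifications `e : Sel_∞^{Γ_K} ≃ Sel_∞^γ`, `e₀ : Sel_{p^∞}(E/K) ≃ Sel_0` and all injections
`κ : M ↪ Sel_{p^∞}(E/K)` of cokernel order `#Ш(E/K)[p^∞]` (only the counts matter). This file certifies that the CANONICAL choices — `e` the
identity on classes (`exists_invariantsZero_addEquiv`), `e₀` the restriction (`exists_selmerLayerZero_addEquiv`), `κ` the `p^∞` Kummer map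
(`exists_kummerToSelmer`) — exist SIMULTANEOUSLY and that the resulting composite `θ = φ_{Sel} ∘ e ∘ s₀ ∘ e₀ ∘ κ` is, on classes, the honest map
**`E(K) ⊗ ℚ_p/ℤ_p → H¹(Γ, Sel_{p^∞}(E/K_∞))`, `t ↦ [res_{K_∞/K} κ(t)]`**: `θ t` is the class modulo `(γ − 1)Sel_∞` of a Selmer class `s` over `K_∞`
whose underlying cohomology class is the restriction to `Gal(K̄/K_∞)` of the Kummer class `κ(t) ∈ H¹(K, E[p^∞])`
(`exists_canonical_derivedKummerMap`; restriction in stages `Γ_K → Gal(K̄/K_0) → Gal(K̄/K_∞)` is restriction, tree `resH1Hom_comp`).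
So «the derived Kummer map θ» of `finite_and_natCard_derivedKummerMap` / `eulerCharAt_iff_shaFreeAt` /
`schneiderLeadingTermFormulaAtTwoSqAt_iff_kerIndexAt_of_prop414` is ONE explicit, choice-free map — the map whose comparison with the canonical
`p`-adic height is Perrin-Riou's / Schneider's theorem at odd `p` and the open point at `p = 2`.

References: [GreenbergLNM1716] §1 pp. 54–62, §2; [CoatesSchneiderSujatha2003] §3 (30); [PerrinRiou1992] §3.4; [Schneider1985].
bears_on: stmt-BirchSwinnertonDyer-23008 (helper; closes nothing), stmt-BirchSwinnertonDyer-22298 (attach seat's item; untouched).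
-/

set_option autoImplicit false
-- the route's Theorems namespace repeats a component by design (summit = sub-problem, D-0017).
set_option linter.dupNamespace false

noncomputable section

open scoped Classical TensorProduct

universe u

namespace Summit.BirchSwinnertonDyer.BirchSwinnertonDyer.Theorems.AlignedTransportAtTwoEulerCharAtTwoAssemblyCanonical

open Literature.NumberTheory.EllipticCurves Literature.NumberTheory.EllipticCurves.IwasawaAlgebra
  Literature.NumberTheory.EllipticCurves.IwasawaDual WeierstrassCurve
  Summit.BirchSwinnertonDyer.BirchSwinnertonDyer.Theorems.AlignedTransportAtTwoEulerCharAtTwoAssembly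
  Summit.BirchSwinnertonDyer.BirchSwinnertonDyer.Theorems.AlignedTransportAtTwoEulerCharAtTwoAssemblyKummer

variable {K : Type u} [Field K] [NumberField K] (W : WeierstrassCurve K) {p : ℕ} [Fact p.Prime]
  (κ : ZpExtension K p) {γ : Field.absoluteGaloisGroup K}

omit [NumberField K] in
/-- **Restriction in stages is restriction**: `h₀ ∘ res_{K_0/K} = res_{K_∞/K}` on `H¹(K, E[p^∞])`, i.e.
`(layerToInfty κ 0) ∘ (H¹(Γ_K) → H¹(Gal(K̄/K_0)))` is the restriction `H¹(Γ_K, E[p^∞]) → H¹(Gal(K̄/K_∞), E[p^∞])` (functoriality,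
tree `resH1Hom_comp`). [folklore] -/
theorem layerToInfty_zero_comp_res :
    (W.layerToInfty κ 0).comp
        (resH1Hom (subgroupIncl (κ.layerSubgroup 0)) (AddMonoidHom.id (geomPrimaryTorsion W p)) (fun _ _ ↦ rfl)) =
      resH1Hom (subgroupIncl κ.kerSubgroup) (AddMonoidHom.id (geomPrimaryTorsion W p)) (fun _ _ ↦ rfl) := by
  show (Literature.NumberTheory.EllipticCurves.resOfLe (geomPrimaryTorsion W p) (κ.kerSubgroup_le_layerSubgroup 0)).comp _ = _
  unfold Literature.NumberTheory.EllipticCurves.resOfLe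
  rw [resH1Hom_comp]
  exact resH1Hom_congr (ContinuousMonoidHom.ext fun _ ↦ rfl) rfl _ _

set_option maxHeartbeats 1000000 in
/-- **The CANONICAL derived Kummer map, on classes (every `p`, every `ℤ_p`-extension of a number field, `γ` a topological generator).**
There are, simultaneously: the identity-on-classes identification `e : Sel_∞^{Γ_K} ≃+ Sel_∞^γ`, the restriction `e₀ : Sel_{p^∞}(E/K) ≃+ Sel_0`,
and the Kummer map `κ : E(K) ⊗ ℚ_p/ℤ_p → Sel_{p^∞}(E/K)` INTO the Selmer group (injective, cokernel of order `#Ш(E/K)[p^∞]`), such that the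
composite `θ = φ_{Sel} ∘ e ∘ s₀ ∘ e₀ ∘ κ` of the assembly satisfies, for every `t`: **`θ t = [s]` for a (unique) Selmer class `s` over `K_∞`
whose cohomology class is `res_{K_∞/K} κ(t)`** — the restriction to `Gal(K̄/K_∞)` of the `p^∞` Kummer class of `t`. Hence every count of
the assembly files applies to this one explicit map. [cite: GreenbergLNM1716, §1 pp. 54–62, §2] [cite: CoatesSchneiderSujatha2003, §3 (30)] -/
theorem exists_canonical_derivedKummerMap [W.IsElliptic] (hγ : κ.IsTopGenerator γ) :
    ∃ (e : ↥(W.selmerInfty κ ⊓ W.layerInvariants κ 0) ≃+ ↥(endInvariants (W.conjSelmerInfty κ γ - 1)))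
      (e₀ : ↥(W.selmerGroupPInfty p) ≃+ ↥(W.selmerLayer κ 0))
      (kS : W.toAffine.Point ⊗[ℤ] PruferQuot p →+ ↥(W.selmerGroupPInfty p)),
      Function.Injective kS ∧
      Nat.card (↥(W.selmerGroupPInfty p) ⧸ kS.range) = Nat.card (AddCommGroup.primaryComponent W.sha p) ∧
      ∀ t : W.toAffine.Point ⊗[ℤ] PruferQuot p, ∃ s : W.selmerInfty κ,
        ((W.selmerInftyEulerMap κ γ).comp
            (((e : ↥(W.selmerInfty κ ⊓ W.layerInvariants κ 0) →+ ↥(endInvariants (W.conjSelmerInfty κ γ - 1))).comp (W.sMap κ 0)).comp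
              ((e₀ : ↥(W.selmerGroupPInfty p) →+ ↥(W.selmerLayer κ 0)).comp kS))) t =
          (s : EndCoinvariants (W.conjSelmerInfty κ γ - 1)) ∧
        (s : W.subgroupH1 p κ.kerSubgroup) =
          resH1Hom (subgroupIncl κ.kerSubgroup) (AddMonoidHom.id (geomPrimaryTorsion W p)) (fun _ _ ↦ rfl)
            (kummerMapPInfty W p W.zsmul_geomPoints_surjective_holds t) := by
  obtain ⟨e, he⟩ := exists_invariantsZero_addEquiv (γ := γ) W κ hγ
  obtain ⟨e₀, he₀⟩ := exists_selmerLayerZero_addEquiv (p := p) W κ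
  obtain ⟨kS, hkS, hinj, hcard⟩ := exists_kummerToSelmer (p := p) W
  refine ⟨e, e₀, kS, hinj, hcard, fun t ↦ ⟨(e (W.sMap κ 0 (e₀ (kS t))) : W.selmerInfty κ), ?_, ?_⟩⟩
  · simp only [AddMonoidHom.coe_comp, Function.comp_apply, AddMonoidHom.coe_coe, eulerMap_apply]
  · rw [he, coe_sMap_apply, he₀, hkS]
    exact DFunLike.congr_fun (layerToInfty_zero_comp_res W κ) _

end Summit.BirchSwinnertonDyer.BirchSwinnertonDyer.Theorems.AlignedTransportAtTwoEulerCharAtTwoAssemblyCanonical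

end
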